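import Summits.BirchSwinnertonDyer.BirchSwinnertonDyer.Theorems.ThetaPartnerAtTwoSignedMainConjectureCMTwoPeriodUnit
import Summits.BirchSwinnertonDyer.BirchSwinnertonDyer.Theorems.ThetaPartnerAtTwoSignedMainConjectureCMTwoRankZeroFlatOfCuspSpan
import Summits.BirchSwinnertonDyer.BirchSwinnertonDyer.Theorems.ResidualThetaTransportAtTwoCuspSpanEvenAtTwoOdd
import HarnessLib

/-!
# Stub `stub_analyticMuCMTwo` for crux K2 `SignedMainConjectureCMTwo` (stmt-BirchSwinnertonDyer-20307)

HONEST FRAMING (cell `pub/bsd-wall`, W-ALL row 1; bench worker g0). The registered stub of skeleton line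
`rankzero` asks for CM `A/ℚ` good supersingular at `2` with `a₂ = 0` and analytic rank `0`: (i) the period
ratio `ϖ` is a 2-adic unit (`padicValRat 2 ϖ = 0`) AND (ii) Kobayashi's `L♭ = kobayashiL 1 L⁺ L⁻` has a
unit coefficient (`μ(L♭) = 0`).

Part (i) is the named fact `realPeriodRat_eq_unit_mul_plusPeriod_two` (Greenberg–Vatsal 2000 / Abbes–Ullmo
1996), read through `padicValRat_periodRatio_eq_zero_two`. Part (ii) follows from the proved node (G')_N
at every odd level (`SignedMuAtTwo.Rows.cuspSpanEvenAtTwo_oddLevel`, item 27436 CLOSED): the conductor is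
odd by good reduction at 2 (`not_two_dvd_conductorNorm_of_goodSS`), then `flatAtTwo_of_conductor_odd`
gives `2 ∤ L⁻`, and `exists_isUnit_coeff_of_not_C_two_dvd` translates to a unit coefficient.

The theorem `analyticMuCMTwo_of_flat` (ThetaPartnerAtTwoSignedMainConjectureCMTwoPeriodUnit.lean) combines
both parts. This file provides the stub proof CONDITIONAL on the named fact `realPeriodRat_eq_unit_mul_plusPeriod_two`.
BSD is NOT proved by this. [cite: GreenbergVatsal2000, §3, Remark 3.4] [cite: AbbesUllmo1996, Thm. A]
[cite: Pollack2003, Conj. 6.3] [cite: Kobayashi2003, (3.6)]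
-/

set_option autoImplicit false
set_option linter.dupNamespace false

noncomputable section

open scoped Classical MatrixGroups ModularForm

open CongruenceSubgroup WeierstrassCurve Literature.NumberTheory.EllipticCurves
  Literature.NumberTheory.EllipticCurves.ModularForms Literature.NumberTheory.EllipticCurves.Rank1Residual
  Literature.NumberTheory.EllipticCurves.Kobayashi2003 ZpExtension
  Summit.BirchSwinnertonDyer.Rank1Residual.Supersingular

namespace Summit.BirchSwinnertonDyer.BirchSwinnertonDyer.Theorems.AnalyticMuCMTwoStub

/-- **The stub `stub_analyticMuCMTwo` holds, conditional on the named fact `realPeriodRat_eq_unit_mul_plusPeriod_two`.**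
For CM `A/ℚ` good supersingular at `2` with `a₂ = 0` and analytic rank `0`, every newform `f` of `A`,
period ratio `ϖ` with `ϖ·Ω_A = Ω⁺_f`, and Pollack pair `(L⁺, L⁻)` at `2`: (i) `padicValRat 2 ϖ = 0` (the
period ratio is a 2-adic unit, from `realPeriodRat_eq_unit_mul_plusPeriod_two`) and (ii) Kobayashi's
`L♭ = kobayashiL 1 L⁺ L⁻` has a unit coefficient (the flat part, from the proved node (G')_N at every
odd level). BSD is NOT proved by this.
[cite: GreenbergVatsal2000, §3, Remark 3.4] [cite: AbbesUllmo1996, Thm. A] [cite: Pollack2003, Conj. 6.3] -/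
theorem stub_analyticMuCMTwo_proof
    (h2 : realPeriodRat_eq_unit_mul_plusPeriod_two) :
    ∀ (A : WeierstrassCurve ℚ) [A.IsElliptic] [A.IsGloballyMinimal],
      A.HasCM → A.analyticRank = 0 → GoodSS A 2 → A.frobeniusTrace 2 = 0 →
      ∀ [NeZero (A.conductorNorm ℤ)] (f : CuspForm (Gamma0 (A.conductorNorm ℤ)) 2),
      IsNewformOf A f → ∀ (ϖ : ℚ), (ϖ : ℝ) * A.realPeriodRat = plusPeriod f →
      ∀ (Lplus Lminus : IwasawaAlgebra 2), IsPollackPair f 2 Lplus Lminus →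
        padicValRat 2 ϖ = 0 ∧ ∃ n : ℕ, IsUnit (PowerSeries.coeff n (kobayashiL 1 Lplus Lminus)) :=
  analyticMuCMTwo_of_flat h2 fun A _ _ _ _ hss ha _ f hf Lplus Lminus hPP ↦
    analyticMuFlatCMTwo_at_of_cuspSpan A hss ha
      ((SignedMuAtTwo.cuspSpanEvenAtTwo_iff (A.conductorNorm ℤ)).mp
        (SignedMuAtTwo.Rows.cuspSpanEvenAtTwo_oddLevel
          (Nat.odd_iff.mpr (Nat.two_dvd_ne_zero.mp
            (SignedMuAtTwo.not_two_dvd_conductorNorm_of_goodSS hss)))))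
      f hf Lplus Lminus hPP

end Summit.BirchSwinnertonDyer.BirchSwinnertonDyer.Theorems.AnalyticMuCMTwoStub

end
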